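import Literature.MathematicalPhysics.QuantumFieldTheory.Balaban1983to89.B9Eq3152GreenPrimeProjGradRowClosed

/-!
# `Balaban1983to89.B9Eq325RofUkSupRowClosed` — T. Bałaban, *Propagators for lattice gauge theories in a background field*, Commun. Math. Phys. **99** (1985) 389–434
# [Balaban1985BackgroundPropagators] (3.25) p. 394 (*«R = I − G′Q′*(Q′G′²Q′*)⁻¹Q′G′»*), (3.19) p. 393, Thm 3.1 (3.42) p. 397, Thm 3.2 (3.48) p. 398, (3.49) p. 399
# (*«These theorems imply all the properties of the operator R … we will need»*): **THE LOCAL SUP LETTERS OF `G′_k`, OF THE PROJECTION `R_k` AND OF `G′_kR_k` ON PRINT's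
# DIAGONAL, ∃-FIRST, AT ONE COMMON RATE** — the site-to-site coefficient letters `(L)(G′; B_G, κ)`, `(L)(R; B_R, κ)` of this lineage's (K72) (and `(L)(G′∘R)` of the right road)
# `B9Eq3130TransferPairLetters.transfer_pair` (PLAN v15 (b), R-ne9p1-g97-1, journal `HOME/CLAIMS.log` l.65987), read off the landed rows: (DRC)
# `exists_decayRow_GpOfUk`, (K64a) `exists_local_letter_QGGQInvk_closed`, the forward ∕ adjoint averaging letters (range `0`, size `1` on the diagonal), and
# `B9Eq325ProjFormulaTower.RofUk_eq_formula` — the (K70) `B9Eq3152GreenPrimeProjGradRowClosed` assembly WITHOUT its outer gradient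

statement-level skeleton of published theorems with citation tags; proofs where landed; nothing here is a claim about the Yang–Mills mass gap

CITATION HEADER (lean-in-tree rule).  Audit cell `pub-balaban`, sub-cell `t4`, BINDER row NE9; filed by NE9 crux-team LEAF PROVER 05
(`b2b-balaban-t4-ne9-formalise-leaf-05`, gen 88), supplier brick (K76a) for the tower END of the pair bootstrap (A-1 (5), journal l.66167).  Composed BY NAME exactly as
(K70) (same generation-87 lineage file, same suppliers, same constants): (DRC) `B9Eq342GreenPrimeTowerDecayRowClosed.exists_decayRow_GpOfUk`, (K64a)
`B9Eq326WoodburyLettersTower.exists_local_letter_QGGQInvk_closed`, `B9Eq324PenaltyPointwiseBound.norm_QtildeTower_le` ∕ `norm_adjoint_QtildeTower_apply_le`,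
`B9Eq324PenaltyBlockLocal.QprimeTowerW_apply_eq_of_eqOn_fibre` ∕ `adjoint_QtildeTower_apply_eq_of_eq_at`, `B9Eq325ProjFormulaTower.RofUk_eq_formula`, (K61) `letter_comp`,
(K63) `letter_of_range`, `B4Sect5Torus.torusSum_le`.  Source READ first-hand this generation (`paper:balaban1985-cmp99-background-propagators`, journal page = PDF page + 388):
pp. 393–399 (3.19)–(3.49).  [folklore] composition; NOTHING of print's Thm 3.1 ∕ 3.2 ∕ (3.49) is asserted, valued or discharged.

WHAT IS PROVED (sorry-free; proof lane — no `def`).  **`exists_local_letters_GpOfUk_RofUk`** — `∃ (α₁, B, δ)`, `0 < α₁`, `0 ≤ B`, `0 < δ`, BEFORE the (K64) ∕ (K70)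
binder block (verbatim: E162's data, the windows, `hRlev`, `hpos′`), such that for every coarse block `v`, every site field `w` supported over the big block `Π⁻¹(v)`
(`Π = blockCoord (L^{n+1}) m ∘ siteCast`) with `‖w‖_∞ ≤ F`, and every fine site `x`:
`‖(G′_k w)(x)‖ ≤ B·e^{−δ·d_m(Πx, v)}·F` AND `‖(R_k w)(x)‖ ≤ B·e^{−δ·d_m(Πx, v)}·F` AND `‖(G′_k(R_k w))(x)‖ ≤ B·e^{−δ·d_m(Πx, v)}·F` — `δ = κ∕2`, `κ = min(κ_P, ρ_c)`,
`B = max(max(B_P, B_R), B_R·B_P·K)`, `B_R = 1 + B_P·K·B_c·K·K·B_P·K`, `K = K_d(κ∕2)`; `R_k w = w − G′_k(Q̃′_k†(c(Q̃′_k(G′_k w))))` by `RofUk_eq_formula`, four `letter_comp` and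
the identity letter for `w` give the (L)-letter of `R_k` as a CLM, a fifth `letter_comp` (outer `G′_k` at rate `κ`, inner `R_k` at `κ∕2`) gives `G′_k∘R_k`.
HONEST SCOPE.  [folklore] composition of landed rows; constants crude; the windows, E162's data, `hRlev`, `ρ_w`, the trace letters and `hpos′` stay HYPOTHESES; nothing of [B9]
asserted; «NE9 ⇐ the named binders»; NE9 NOT PRINTED ∕ NOT PROVED; row WALLED ON A MODEL (O-NE9-1; #5 UNRULED); spine PROVED 0∕9; rung (B)+1 on a finite T⁴ — NOT infinite
volume, NOT mass gap, NOT BetaPertH, NOT Clay.  HONEST DEPENDENCY: continuum YM on T⁴ ⇐ BetaPertH ∧ nine spine estimates (0/9 proved); BetaPertH ⇐ (D1) ∧ (D4) ∧ CAP+tail;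
G-an2-4 gates asym, D1 and NE2/3/4.  NEW file importing (K70) only (BUILT; it carries every supplier); nothing modified.  Net new unproved facts: 0.
-/

noncomputable section

set_option autoImplicit false

open scoped InnerProductSpace ComplexConjugate BigOperators

namespace Literature.MathematicalPhysics.QuantumFieldTheory.Balaban1983to89.B9Eq325RofUkSupRowClosed

open B4Sect5Torus (TSite tdist tdist_nonneg tdist_symm tdist_self tdist_triangle torusSum_le)
open B4Sect5Proof (latticeConst latticeConst_nonneg)
open B9SectCLatticeCarrier (Bond DirPair bpos btgt shift unshift)
open B9Eq311L2Pairing (WL2)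
open B9Eq319QprimeTorus (fineP blockCoord)
open B7Prop1Explicit (U1 Wcx boxVec)
open B11Eq103H1Complex (SiteL2K BondL2K greenK covDerivL2K)
open B9Eq310DeltaPrime (plaqHolU)
open B9Eq310HessianOperator (adTransportW)
open B9Eq310HessianHermitian (adTransportW_adjoint)
open B9Eq315QTorus (perCfg cornerSite)
open B9Eq315QTower (towerP UlevOf)
open B9Eq316TowerFlatIsOneStep (towerP_eq_fineP_pow siteCast)
open B9Eq326OperatorTower (QprimeTowerW RofUk)
open B9Eq324DeltaPrimeATower (laplacePrimeAk GpOfUk)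
open B9Eq325ProjFormulaTower (QGGQk_pos RofUk_eq_formula)
open B9Eq349BlockMultipliers (exists_block_clm_family)
open B9Eq326WoodburyLettersTower (exists_local_letter_QGGQInvk_closed)
open B9Eq342GreenPrimeTowerDecayRowClosed (exists_decayRow_GpOfUk)
open B9Eq324PenaltyPointwiseBound (norm_QtildeTower_le norm_adjoint_QtildeTower_apply_le)
open B9Eq324PenaltyBlockLocal (QprimeTowerW_apply_eq_of_eqOn_fibre adjoint_QtildeTower_apply_eq_of_eq_at)
open B9Eq342GreenPrimeTowerSupBoundDecay (bigBlock_eq_iff)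
open B9Eq342TowerBigBlocks (card_sites_bigBlock_le)

open B9Eq347LocalFromBlockDecay (norm_le_sqrt_mass_mul)
open B9Eq326G1SupRowOfLetters (letter_comp)
open B9Eq3126H1SupRowOfLetters (letter_of_range)

variable {d : ℕ} (hd : 1 ≤ d) (L : ℕ) [NeZero L] (hL : 1 ≤ L) (hL3 : 3 ≤ L)
  {𝔸 : Type*} [NormedRing 𝔸] [NormedAlgebra ℂ 𝔸] [CompleteSpace 𝔸] [NormOneClass 𝔸] [StarRing 𝔸] [NormedStarGroup 𝔸] [StarModule ℂ 𝔸]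
  {W : Type*} [NormedAddCommGroup W] [InnerProductSpace ℂ W] [FiniteDimensional ℂ W] (φ : W ≃ₗ[ℂ] 𝔸)
  {Mφ Mφ' : ℝ} (hMφ : 0 ≤ Mφ) (hMφ' : 0 ≤ Mφ') (hφ : ∀ w, ‖φ w‖ ≤ Mφ * ‖w‖) (hφ' : ∀ X, ‖φ.symm X‖ ≤ Mφ' * ‖X‖) (hstar : ∀ X : 𝔸, ‖star X‖ ≤ ‖X‖)
  {a : ℝ} (ha : 0 < a) {a' : ℝ} (ha' : 0 < a') {ϱ : ℝ} (hϱ0 : 0 ≤ ϱ) (hϱ1 : ϱ < 1)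
  (τ : 𝔸 →ₗ[ℂ] ℂ) {Cτ : ℝ} (hτ : ∀ X, ‖τ X‖ ≤ Cτ * ‖X‖) (hCτ : 0 ≤ Cτ) {Mτ : ℝ} (hτm : ∀ X Y : 𝔸, ‖τ (X * Y)‖ ≤ Mτ * ‖X‖ * ‖Y‖) (hMτ : 0 ≤ Mτ)
  {ρw : ℝ} (hρw : 0 ≤ ρw)
  (hτ₁ : ∀ X : 𝔸, τ (star X) = conj (τ X)) (hτ₂ : ∀ X Y : 𝔸, τ (X * Y) = τ (Y * X)) (hφτ : ∀ X Y : 𝔸, ⟪φ.symm X, φ.symm Y⟫_ℂ = τ (star X * Y))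
  (AQ : ℝ)

omit [NeZero L] in
/-- `e^{−r t} ≤ e^{−κ t}` for `κ ≤ r`, `0 ≤ t`. [folklore] -/
private theorem exp_weaken' {r κ t : ℝ} (hκ : κ ≤ r) (ht : 0 ≤ t) : Real.exp (-(r * t)) ≤ Real.exp (-(κ * t)) :=
  Real.exp_le_exp.2 (by nlinarith)

include hd hL hL3 hMφ hMφ' hφ hφ' ha ha' hϱ0 hϱ1 hτ hCτ hMτ hρw hτ₁ hτ₂ hφτ in
/-- **THE SUP LETTERS OF `G′_k`, OF `R_k` AND OF `G′_kR_k` ON PRINT's DIAGONAL, ∃-FIRST, AT ONE RATE** — (DRC) `exists_decayRow_GpOfUk` (`(α_P, C_P, ρ_P, κ_P)`) for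
`G′_k` (four times), (K64a) `exists_local_letter_QGGQInvk_closed` for `c`, the forward ∕ adjoint averaging letters (range `0`, size `1` on the diagonal), `RofUk_eq_formula`
(`R_kw = w − G′_k(Q̃′_k†(c(Q̃′_k(G′_kw))))`), four (K61) `letter_comp` with `torusSum_le` (rate lost once: `δ := κ∕2`, `κ := min(κ_P, ρ_c)`) and the identity letter for
`w` give (L)(R_k; B_R, κ∕2) as a CLM letter, a fifth `letter_comp` gives (L)(G′_k∘R_k; B_R·B_P·K, κ∕2); `B = max(max(B_P, B_R), B_R·B_P·K)`, `B_R = 1 + B_P·K·B_c·K·K·B_P·K`,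
`K = K_d(κ∕2)`. [cite: Balaban1985BackgroundPropagators, (3.25) p.394, (3.19) p.393, Thm 3.1 (3.42) p.397, Thm 3.2 (3.48)
p.398, (3.49) p.399, Thm 3.11 p.416] -/
theorem exists_local_letters_GpOfUk_RofUk :
    ∃ α₁ B δ : ℝ, 0 < α₁ ∧ 0 ≤ B ∧ 0 < δ ∧
      ∀ (n : ℕ) (η : ℝ) (_hηL : η * (L : ℝ) ^ (n + 1) = 1) (c₀ c₁ : ℝ) [Fact (0 < c₀)] [Fact (0 < c₁)]
        (_hw : c₀ * ((L : ℝ) ^ (n + 1)) ^ d = c₁) (_hρ : |η| ^ d / c₀ ≤ ρw) (m : Fin d → ℕ) [∀ i, NeZero (m i)] (_hm : ∀ i, 1 ≤ m i)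
        (U : Bond d (towerP L m (n + 1)) → 𝔸ˣ) (αU : ℕ → ℝ) (_hα0 : ∀ j, 0 ≤ αU j) (hα1 : ∀ j, αU j ≤ 1 / 64)
        (hU1 : ∀ (j : ℕ) (x : B7Prop1Explicit.Site d) (k : Fin d), perCfg (towerP L m (j + 1)) (UlevOf L m (n + 1) U j) x k ∈ U1 𝔸)
        (hreg : ∀ (j : ℕ) (y : TSite d (towerP L m j)) (k : Fin d) (ρ' : Fin d → Fin L),
          ‖((Wcx L (perCfg (towerP L m (j + 1)) (UlevOf L m (n + 1) U j)) (cornerSite L y) k (boxVec L ρ') : 𝔸ˣ) : 𝔸) - 1‖ ≤ αU j)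
        (εU : ℕ → ℝ) (_hεU : ∀ j, 0 ≤ εU j) (_hUε : ∀ (j : ℕ) (b : Bond d (towerP L m (j + 1))), ‖(UlevOf L m (n + 1) U j b : 𝔸) - 1‖ ≤ εU j)
        (_hLb : ∀ (j : ℕ) (b : Bond d (towerP L m (j + 1))), UlevOf L m (n + 1) U j b ∈ U1 𝔸)
        (α : ℝ) (_hα : 0 ≤ α) (_hαle : α ≤ α₁)
        (hUst : ∀ b, star (U b : 𝔸) = (((U b)⁻¹ : 𝔸ˣ) : 𝔸)) (_hUb : ∀ b, U b ∈ U1 𝔸) (_hUη : ∀ b, ‖(U b : 𝔸) - 1‖ ≤ α * η)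
        (_hpl : ∀ p : B9SectCLatticeCarrier.Plaq d (towerP L m (n + 1)), ‖(plaqHolU U p : 𝔸) - 1‖ ≤ α * η ^ 2)
        (_hUgrad : ∀ (x : TSite d (towerP L m (n + 1))) (μ : Fin d), ‖(U (x, μ) : 𝔸) - U (unshift μ x, μ)‖ ≤ α * η ^ 2)
        (_hRlev : ∀ (j : ℕ) (b : Bond d (towerP L m (j + 1))) (w : W), ‖adTransportW φ (UlevOf L m (n + 1) U j) b w‖ ≤ ‖w‖)
        (_hεg : ∀ j < n + 1, εU j ≤ α * ϱ ^ j) (_hAQ : ∑ j ∈ Finset.range (n + 1), αU j ≤ AQ)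
        (hpos' : ∀ x : SiteL2K ℂ d (towerP L m (n + 1)) c₀ W, x ≠ 0 → 0 < RCLike.re ⟪x, laplacePrimeAk L m n φ η U a' (c₁ := c₁) x⟫_ℂ)
        (v : TSite d m) (w : SiteL2K ℂ d (towerP L m (n + 1)) c₀ W) (F : ℝ)
        (_hwv : ∀ x, blockCoord (L ^ (n + 1)) m (siteCast (towerP_eq_fineP_pow L m (n + 1)) x) ≠ v →
          WL2.equiv ℂ (fun _ : TSite d (towerP L m (n + 1)) => c₀) W w x = 0)
        (_hwF : ∀ x, ‖WL2.equiv ℂ (fun _ : TSite d (towerP L m (n + 1)) => c₀) W w x‖ ≤ F) (x : TSite d (towerP L m (n + 1))),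
        ‖WL2.equiv ℂ (fun _ : TSite d (towerP L m (n + 1)) => c₀) W (GpOfUk L m n φ η U a' (c₁ := c₁) hpos' w) x‖ ≤
            B * Real.exp (-(δ * tdist m (blockCoord (L ^ (n + 1)) m (siteCast (towerP_eq_fineP_pow L m (n + 1)) x)) v)) * F ∧
          ‖WL2.equiv ℂ (fun _ : TSite d (towerP L m (n + 1)) => c₀) W (RofUk L m n φ η U (c₀ := c₀) w) x‖ ≤
            B * Real.exp (-(δ * tdist m (blockCoord (L ^ (n + 1)) m (siteCast (towerP_eq_fineP_pow L m (n + 1)) x)) v)) * F ∧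
          ‖WL2.equiv ℂ (fun _ : TSite d (towerP L m (n + 1)) => c₀) W
              (GpOfUk L m n φ η U a' (c₁ := c₁) hpos' (RofUk L m n φ η U (c₀ := c₀) w)) x‖ ≤
            B * Real.exp (-(δ * tdist m (blockCoord (L ^ (n + 1)) m (siteCast (towerP_eq_fineP_pow L m (n + 1)) x)) v)) * F := by
  classical
  obtain ⟨αP, CP, ρP, κP, hαP, hCP, hρP, hκP, _hκPρ, h2κP, HP⟩ := exists_decayRow_GpOfUk L φ hMφ hMφ' hφ hφ' ha' hϱ0 hϱ1 τ hτ₂ hφτ hd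
  obtain ⟨αC, BC, ρC, hαC, hBC, hρC, HC⟩ := exists_local_letter_QGGQInvk_closed hd L hL hL3 φ hMφ hMφ' hφ hφ' ha ha' hϱ0 hϱ1 τ hτ hCτ hρw hτ₁ hτ₂ hφτ hMτ
  -- (DRC)'s constant
  set BP : ℝ := ((1 + |a'| * CP) * (Real.exp (1 / 2) * 2) * (∑ l ∈ Finset.range d, (2 : ℝ) ^ (l + 1)) +
      Real.sqrt (3 ^ d * 2 ^ d) * Real.sqrt ((Real.exp (1 / 2) * 2) * latticeConst d (Real.sqrt (1 / (4 * d + 1)) - 2 * κP)) * CP) with hBP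
  have hBP0 : 0 ≤ BP := by positivity
  -- the common rate and window
  obtain ⟨κ, hκdef⟩ : ∃ κ : ℝ, κ = min κP ρC := ⟨_, rfl⟩
  have hκ0 : 0 < κ := by rw [hκdef]; exact lt_min hκP hρC
  have hκP' : κ ≤ κP := by rw [hκdef]; exact min_le_left _ _
  have hκC' : κ ≤ ρC := by rw [hκdef]; exact min_le_right _ _
  obtain ⟨αs, hαs⟩ : ∃ αs : ℝ, αs = min αP αC := ⟨_, rfl⟩
  have hαs0 : 0 < αs := by rw [hαs]; exact lt_min hαP hαC
  obtain ⟨K, hKdef⟩ : ∃ K : ℝ, K = latticeConst d (κ - κ / 2) := ⟨_, rfl⟩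
  have hK0 : 0 ≤ K := by rw [hKdef]; exact latticeConst_nonneg d (sub_pos.2 (half_lt_self hκ0)).le
  obtain ⟨BRr, hBRr⟩ : ∃ B' : ℝ, B' = 1 + BP * (1 * Real.exp (κ * 0)) * K * BC * K * (1 * Real.exp (κ * 0)) * K * BP * K := ⟨_, rfl⟩
  obtain ⟨Bs, hBs⟩ : ∃ Bs : ℝ, Bs = max (max BP BRr) (BRr * BP * K) := ⟨_, rfl⟩
  have hBs0 : 0 ≤ Bs := by rw [hBs]; exact hBP0.trans ((le_max_left _ _).trans (le_max_left _ _))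
  refine ⟨αs, Bs, κ / 2, hαs0, hBs0, by positivity, ?_⟩
  intro n η hηL c₀ c₁ _ _ hw hρ m _ hm U αU hα0 hα1 hU1 hreg εU hεU hUε hLb α hα hαle hUst hUb hUη hpl hUgrad hRlev hεg hAQ hpos' v w F hwv hwF x
  have hc₀ : (0 : ℝ) < c₀ := Fact.out
  have hc₁ : (0 : ℝ) < c₁ := Fact.out
  haveI : Nonempty (TSite d (towerP L m (n + 1))) := ⟨x⟩
  haveI : Nonempty (TSite d m) := ⟨v⟩
  have hF0 : 0 ≤ F := (norm_nonneg _).trans (hwF x)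
  have hRS : ∀ (b : Bond d (towerP L m (n + 1))) (v u : W), ⟪adTransportW φ U b v, u⟫_ℂ = ⟪v, adTransportW φ (fun b => (U b)⁻¹) b u⟫_ℂ :=
    adTransportW_adjoint φ τ hτ₂ hUst hφτ
  have hαP_ : α ≤ αP := hαle.trans (by rw [hαs]; exact min_le_left _ _)
  have hαC_ : α ≤ αC := hαle.trans (by rw [hαs]; exact min_le_right _ _)
  -- the block families: fine sites by their big block, coarse sites by themselves
  obtain ⟨PS, hPS⟩ := exists_block_clm_family (𝕜 := ℂ) (w := fun _ : TSite d (towerP L m (n + 1)) => c₀) (V := W)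
    (fun x : TSite d (towerP L m (n + 1)) => blockCoord (L ^ (n + 1)) m (siteCast (towerP_eq_fineP_pow L m (n + 1)) x))
  obtain ⟨rY, hrY⟩ := exists_block_clm_family (𝕜 := ℂ) (w := fun _ : TSite d m => c₁) (V := W) (id : TSite d m → TSite d m)
  -- the letters `Q̃′_k`, `Q̃′_k†`, `c`, `G′_k` as linear maps, then as CLMs
  obtain ⟨Qt, hQt⟩ : ∃ Qt : SiteL2K ℂ d (towerP L m (n + 1)) c₀ W →ₗ[ℂ] SiteL2K ℂ d m c₁ W,
      Qt = (WL2.linearEquiv ℂ ℂ (fun _ : TSite d m => c₁)).symm.toLinearMap ∘ₗ QprimeTowerW L m n φ U (c₀ := c₀) := ⟨_, rfl⟩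
  obtain ⟨c, hc⟩ : ∃ c : SiteL2K ℂ d m c₁ W →ₗ[ℂ] SiteL2K ℂ d m c₁ W, c = greenK _ (QGGQk_pos L m n φ c₀ η U c₁ a' hRS hpos') := ⟨_, rfl⟩
  obtain ⟨GPcl, hGPcl⟩ : ∃ T : SiteL2K ℂ d (towerP L m (n + 1)) c₀ W →L[ℂ] SiteL2K ℂ d (towerP L m (n + 1)) c₀ W,
      T = LinearMap.toContinuousLinearMap (GpOfUk L m n φ η U a' (c₁ := c₁) hpos') := ⟨_, rfl⟩
  obtain ⟨Rcl, hRcl⟩ : ∃ T : SiteL2K ℂ d (towerP L m (n + 1)) c₀ W →L[ℂ] SiteL2K ℂ d (towerP L m (n + 1)) c₀ W,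
      T = LinearMap.toContinuousLinearMap (RofUk L m n φ η U (c₀ := c₀)) := ⟨_, rfl⟩
  obtain ⟨Qcl, hQcl⟩ : ∃ T : SiteL2K ℂ d (towerP L m (n + 1)) c₀ W →L[ℂ] SiteL2K ℂ d m c₁ W, T = LinearMap.toContinuousLinearMap Qt := ⟨_, rfl⟩
  obtain ⟨Qacl, hQacl⟩ : ∃ T : SiteL2K ℂ d m c₁ W →L[ℂ] SiteL2K ℂ d (towerP L m (n + 1)) c₀ W,
      T = LinearMap.toContinuousLinearMap (LinearMap.adjoint Qt) := ⟨_, rfl⟩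
  obtain ⟨Ccl, hCcl⟩ : ∃ T : SiteL2K ℂ d m c₁ W →L[ℂ] SiteL2K ℂ d m c₁ W, T = LinearMap.toContinuousLinearMap c := ⟨_, rfl⟩
  -- (L)(G′_k) at rate κ
  have hGp : ∀ (v : TSite d m) (f : SiteL2K ℂ d (towerP L m (n + 1)) c₀ W) (F : ℝ),
      (∀ x, blockCoord (L ^ (n + 1)) m (siteCast (towerP_eq_fineP_pow L m (n + 1)) x) ≠ v →
        WL2.equiv ℂ (fun _ : TSite d (towerP L m (n + 1)) => c₀) W f x = 0) →
      (∀ x, ‖WL2.equiv ℂ (fun _ : TSite d (towerP L m (n + 1)) => c₀) W f x‖ ≤ F) →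
      ∀ x, ‖WL2.equiv ℂ (fun _ : TSite d (towerP L m (n + 1)) => c₀) W (GPcl f) x‖ ≤
        BP * Real.exp (-(κ * tdist m (blockCoord (L ^ (n + 1)) m (siteCast (towerP_eq_fineP_pow L m (n + 1)) x)) v)) * F := by
    intro v f F hfv hfF x
    have hF : 0 ≤ F := (norm_nonneg _).trans (hfF x)
    have h := HP n η hηL c₀ c₁ hw m U hRS α hα hαP_ hUb hUη εU hεU hεg hUε hLb hUst hRlev hpos' PS hPS v x f F hfv hfF
    rw [hGPcl, LinearMap.coe_toContinuousLinearMap']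
    calc _ ≤ BP * Real.exp (-(κP * tdist m (blockCoord (L ^ (n + 1)) m (siteCast (towerP_eq_fineP_pow L m (n + 1)) x)) v)) * F := h
      _ ≤ _ := mul_le_mul_of_nonneg_right (mul_le_mul_of_nonneg_left (exp_weaken' hκP' (tdist_nonneg m _ _)) hBP0) hF
  -- the FORWARD averaging `Q̃′_k`: value at `y` reads the fibre of `y` only; size `sup` on the diagonal
  have eQ : ∀ (f : SiteL2K ℂ d (towerP L m (n + 1)) c₀ W) (y : TSite d m),
      WL2.equiv ℂ (fun _ : TSite d m => c₁) W (Qcl f) y = QprimeTowerW L m n φ U (c₀ := c₀) f y := by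
    intro f y
    rw [hQcl, LinearMap.coe_toContinuousLinearMap', hQt]
    rfl
  have hμS : ∀ y : TSite d m, ∑ x : TSite d (towerP L m (n + 1)),
      (if blockCoord (L ^ (n + 1)) m (siteCast (towerP_eq_fineP_pow L m (n + 1)) x) = y then c₀ else 0) ≤ c₁ := by
    intro y
    rw [← Finset.sum_filter, Finset.sum_const, nsmul_eq_mul, ← hw]
    have h := card_sites_bigBlock_le L m (n + 1) y
    have h' : ((Finset.univ.filter (fun x : TSite d (towerP L m (n + 1)) =>
        blockCoord (L ^ (n + 1)) m (siteCast (towerP_eq_fineP_pow L m (n + 1)) x) = y)).card : ℝ) ≤ ((L : ℝ) ^ (n + 1)) ^ d := by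
      exact_mod_cast h
    rw [mul_comm]
    exact mul_le_mul_of_nonneg_left h' hc₀.le
  have hQM : ∀ (f : SiteL2K ℂ d (towerP L m (n + 1)) c₀ W) (F : ℝ),
      (∀ x, ‖WL2.equiv ℂ (fun _ : TSite d (towerP L m (n + 1)) => c₀) W f x‖ ≤ F) →
      ∀ y, ‖WL2.equiv ℂ (fun _ : TSite d m => c₁) W (Qcl f) y‖ ≤ 1 * F := by
    intro f F hfF y
    have hF : 0 ≤ F := (norm_nonneg _).trans (hfF x)
    -- restrict to the fibre of `y`
    have hloc : WL2.equiv ℂ (fun _ : TSite d m => c₁) W (Qcl f) y = WL2.equiv ℂ (fun _ : TSite d m => c₁) W (Qcl (PS y f)) y := by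
      rw [eQ, eQ]
      refine QprimeTowerW_apply_eq_of_eqOn_fibre L m n φ U f (PS y f) y (fun x hx => ?_)
      rw [hPS, if_pos ((bigBlock_eq_iff L m n x y).2 hx)]
    rw [hloc]
    -- the restricted field: block-supported, sup ≤ F, hence `‖·‖_{c₀} ≤ √c₁·F`
    have hn : ‖PS y f‖ ≤ Real.sqrt c₁ * F :=
      norm_le_sqrt_mass_mul (w := fun _ : TSite d (towerP L m (n + 1)) => c₀)
        (π := fun x : TSite d (towerP L m (n + 1)) => blockCoord (L ^ (n + 1)) m (siteCast (towerP_eq_fineP_pow L m (n + 1)) x))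
        y (hμS y) (PS y f) hF (fun x hx => by rw [hPS, if_neg hx]) (fun x => by
          rw [hPS]
          by_cases hx : blockCoord (L ^ (n + 1)) m (siteCast (towerP_eq_fineP_pow L m (n + 1)) x) = y
          · rw [if_pos hx]; exact hfF x
          · rw [if_neg hx, norm_zero]; exact hF)
    -- the `L²` letter of `Q̃′_k` (= `1` on the diagonal) and one term of the `c₁`-weighted norm
    have h2 := norm_QtildeTower_le L m n φ (c₀ := c₀) (c₁ := c₁) U hRlev (PS y f)
    have hdiag : Real.sqrt (c₁ / (c₀ * ((L : ℝ) ^ (n + 1)) ^ d)) = 1 := by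
      rw [← hw, div_self (ne_of_gt (by positivity)), Real.sqrt_one]
    rw [hdiag, one_mul] at h2
    have h1 := WL2.weight_mul_norm_sq_apply_le (𝕜 := ℂ) (w := fun _ : TSite d m => c₁) (Qcl (PS y f)) y
    have hQn : ‖Qcl (PS y f)‖ ≤ Real.sqrt c₁ * F := by
      rw [hQcl, LinearMap.coe_toContinuousLinearMap', hQt]
      exact h2.trans hn
    have hsq : c₁ * ‖WL2.equiv ℂ (fun _ : TSite d m => c₁) W (Qcl (PS y f)) y‖ ^ 2 ≤ (Real.sqrt c₁ * F) ^ 2 :=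
      h1.trans (pow_le_pow_left₀ (norm_nonneg _) hQn 2)
    rw [mul_pow, Real.sq_sqrt hc₁.le] at hsq
    have hsq' : ‖WL2.equiv ℂ (fun _ : TSite d m => c₁) W (Qcl (PS y f)) y‖ ^ 2 ≤ F ^ 2 := le_of_mul_le_mul_left (by linarith) hc₁
    rw [one_mul]
    exact (pow_le_pow_iff_left₀ (norm_nonneg _) hF two_ne_zero).1 hsq'
  have hQρ : ∀ (v : TSite d m) (f : SiteL2K ℂ d (towerP L m (n + 1)) c₀ W),
      (∀ x, blockCoord (L ^ (n + 1)) m (siteCast (towerP_eq_fineP_pow L m (n + 1)) x) ≠ v →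
        WL2.equiv ℂ (fun _ : TSite d (towerP L m (n + 1)) => c₀) W f x = 0) →
      ∀ y, (0 : ℝ) < tdist m (id y) v → WL2.equiv ℂ (fun _ : TSite d m => c₁) W (Qcl f) y = 0 := by
    intro v f hfv y hy
    have hyv : y ≠ v := by
      intro hyv
      have h0 : tdist m (id y) v = 0 := by rw [show id y = y from rfl, hyv, tdist_self]
      rw [h0] at hy
      exact lt_irrefl _ hy
    have hloc : WL2.equiv ℂ (fun _ : TSite d m => c₁) W (Qcl f) y = WL2.equiv ℂ (fun _ : TSite d m => c₁) W (Qcl 0) y := by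
      rw [eQ, eQ]
      refine QprimeTowerW_apply_eq_of_eqOn_fibre L m n φ U f 0 y (fun x hx => ?_)
      have hxy : blockCoord (L ^ (n + 1)) m (siteCast (towerP_eq_fineP_pow L m (n + 1)) x) = y := (bigBlock_eq_iff L m n x y).2 hx
      rw [hfv x (by rw [hxy]; exact hyv), WL2.equiv_zero, Pi.zero_apply]
    rw [hloc, map_zero, WL2.equiv_zero, Pi.zero_apply]
  have hQ := letter_of_range (tdist m)
    (fun x : TSite d (towerP L m (n + 1)) => blockCoord (L ^ (n + 1)) m (siteCast (towerP_eq_fineP_pow L m (n + 1)) x))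
    (id : TSite d m → TSite d m) Qcl (M := 1) (ρ := 0) (κ := κ) hκ0.le hQM hQρ
  -- the ADJOINT averaging `Q̃′_k†`: value at `x` reads `g(Πx)` only; size `‖g‖_∞` on the diagonal ((K64) §2's two steps)
  have hQaM : ∀ (g : SiteL2K ℂ d m c₁ W) (Gs : ℝ), (∀ u, ‖WL2.equiv ℂ (fun _ : TSite d m => c₁) W g u‖ ≤ Gs) →
      ∀ x, ‖WL2.equiv ℂ (fun _ : TSite d (towerP L m (n + 1)) => c₀) W (Qacl g) x‖ ≤ 1 * Gs := by
    intro g Gs hgG x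
    have hG0 : 0 ≤ Gs := (norm_nonneg _).trans (hgG v)
    obtain ⟨z₀, hz₀⟩ : ∃ z₀ : TSite d m, z₀ = blockCoord (L ^ (n + 1)) m (siteCast (towerP_eq_fineP_pow L m (n + 1)) x) := ⟨_, rfl⟩
    -- restrict `g` to the one coarse point `Πx`
    have hloc : WL2.equiv ℂ (fun _ : TSite d (towerP L m (n + 1)) => c₀) W (Qacl g) x =
        WL2.equiv ℂ (fun _ : TSite d (towerP L m (n + 1)) => c₀) W (Qacl (rY z₀ g)) x := by
      rw [hQacl, LinearMap.coe_toContinuousLinearMap', hQt]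
      exact adjoint_QtildeTower_apply_eq_of_eq_at L m n φ (c₀ := c₀) U g (rY z₀ g) x (fun z hz => by
        have hz' : blockCoord (L ^ (n + 1)) m (siteCast (towerP_eq_fineP_pow L m (n + 1)) x) = z := (bigBlock_eq_iff L m n x z).2 hz
        rw [hrY, if_pos (show id z = z₀ from hz'.symm.trans hz₀.symm)])
    rw [hloc]
    have hμ : ∑ y : TSite d m, (if id y = z₀ then c₁ else 0) ≤ c₁ := by
      show ∑ y : TSite d m, (if y = z₀ then c₁ else 0) ≤ c₁
      rw [Finset.sum_ite_eq' Finset.univ z₀ (fun _ => c₁), if_pos (Finset.mem_univ _)]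
    have hgn : ‖rY z₀ g‖ ≤ Real.sqrt c₁ * Gs :=
      norm_le_sqrt_mass_mul (π := id) (w := fun _ : TSite d m => c₁) z₀ hμ (rY z₀ g) hG0 (fun y hy => by rw [hrY, if_neg hy])
        (fun y => by
          rw [hrY]
          by_cases hy : id y = z₀
          · rw [if_pos hy]; exact hgG y
          · rw [if_neg hy, norm_zero]; exact hG0)
    have e := norm_adjoint_QtildeTower_apply_le L m n φ (c₀ := c₀) U hRlev (rY z₀ g) x
    rw [hQacl, LinearMap.coe_toContinuousLinearMap', hQt]
    refine e.trans ?_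
    have hLp : (0 : ℝ) < ((L : ℝ) ^ (n + 1)) ^ d := by positivity
    calc Real.sqrt c₁ * (((L : ℝ) ^ (n + 1)) ^ d)⁻¹ / c₀ * ‖rY z₀ g‖
        ≤ Real.sqrt c₁ * (((L : ℝ) ^ (n + 1)) ^ d)⁻¹ / c₀ * (Real.sqrt c₁ * Gs) := by gcongr
      _ = c₁ / (c₀ * ((L : ℝ) ^ (n + 1)) ^ d) * Gs := by
          rw [show Real.sqrt c₁ * (((L : ℝ) ^ (n + 1)) ^ d)⁻¹ / c₀ * (Real.sqrt c₁ * Gs) =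
            Real.sqrt c₁ * Real.sqrt c₁ * ((((L : ℝ) ^ (n + 1)) ^ d)⁻¹ / c₀) * Gs by ring, Real.mul_self_sqrt hc₁.le]
          field_simp
      _ = 1 * Gs := by rw [← hw, div_self (ne_of_gt (by positivity)), one_mul]
  have hQaρ : ∀ (v : TSite d m) (g : SiteL2K ℂ d m c₁ W), (∀ u, id u ≠ v → WL2.equiv ℂ (fun _ : TSite d m => c₁) W g u = 0) →
      ∀ x, (0 : ℝ) < tdist m (blockCoord (L ^ (n + 1)) m (siteCast (towerP_eq_fineP_pow L m (n + 1)) x)) v →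
        WL2.equiv ℂ (fun _ : TSite d (towerP L m (n + 1)) => c₀) W (Qacl g) x = 0 := by
    intro v g hgv x hx
    have hxv : blockCoord (L ^ (n + 1)) m (siteCast (towerP_eq_fineP_pow L m (n + 1)) x) ≠ v := by
      intro hxv
      have h0 : tdist m (blockCoord (L ^ (n + 1)) m (siteCast (towerP_eq_fineP_pow L m (n + 1)) x)) v = 0 := by rw [hxv, tdist_self]
      rw [h0] at hx
      exact lt_irrefl _ hx
    have e := adjoint_QtildeTower_apply_eq_of_eq_at L m n φ (c₀ := c₀) U g 0 x (fun z hz => by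
      have hz' : blockCoord (L ^ (n + 1)) m (siteCast (towerP_eq_fineP_pow L m (n + 1)) x) = z := (bigBlock_eq_iff L m n x z).2 hz
      have hzv : z ≠ v := fun hzv => hxv (hz'.trans hzv)
      rw [hgv z hzv, WL2.equiv_zero, Pi.zero_apply])
    rw [hQacl, LinearMap.coe_toContinuousLinearMap', hQt, e, map_zero, WL2.equiv_zero, Pi.zero_apply]
  have hQa := letter_of_range (tdist m) (id : TSite d m → TSite d m)
    (fun x : TSite d (towerP L m (n + 1)) => blockCoord (L ^ (n + 1)) m (siteCast (towerP_eq_fineP_pow L m (n + 1)) x)) Qacl (M := 1) (ρ := 0) (κ := κ) hκ0.le hQaM hQaρ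
  have hCk : ∀ (v : TSite d m) (g : SiteL2K ℂ d m c₁ W) (F : ℝ), (∀ u, id u ≠ v → WL2.equiv ℂ (fun _ : TSite d m => c₁) W g u = 0) →
      (∀ u, ‖WL2.equiv ℂ (fun _ : TSite d m => c₁) W g u‖ ≤ F) →
      ∀ u, ‖WL2.equiv ℂ (fun _ : TSite d m => c₁) W (Ccl g) u‖ ≤ BC * Real.exp (-(κ * tdist m (id u) v)) * F := by
    intro v g F hgv hgF u
    have hF : 0 ≤ F := (norm_nonneg _).trans (hgF v)
    have h := HC n η hηL c₀ c₁ hw hρ m hm U αU hα1 hU1 hreg εU hεU hUε hLb α hα hαC_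
      hUst hUb hUη hpl hεg hpos' rY hrY v g F (fun y hy => hgv y hy) hgF u
    rw [hCcl, LinearMap.coe_toContinuousLinearMap', hc]
    exact h.trans (mul_le_mul_of_nonneg_right (mul_le_mul_of_nonneg_left (exp_weaken' hκC' (tdist_nonneg m _ _)) hBC) hF)
  -- the four compositions on the coarse torus (rate lost once)
  have hgap : 0 < κ - κ / 2 := sub_pos.2 (half_lt_self hκ0)
  have hκh0 : (0 : ℝ) ≤ κ / 2 := (half_pos hκ0).le
  have hκh : κ / 2 ≤ κ := half_le_self hκ0.le
  have he0 : (0 : ℝ) ≤ 1 * Real.exp (κ * 0) := mul_nonneg zero_le_one (Real.exp_nonneg _)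
  have hB1 : (0 : ℝ) ≤ BP * (1 * Real.exp (κ * 0)) * K := mul_nonneg (mul_nonneg hBP0 he0) hK0
  have hB2 : (0 : ℝ) ≤ BP * (1 * Real.exp (κ * 0)) * K * BC * K := mul_nonneg (mul_nonneg hB1 hBC) hK0
  have hB3 : (0 : ℝ) ≤ BP * (1 * Real.exp (κ * 0)) * K * BC * K * (1 * Real.exp (κ * 0)) * K := mul_nonneg (mul_nonneg hB2 he0) hK0
  have hS : ∀ w' : TSite d m, ∑ u : TSite d m, Real.exp (-((κ - κ / 2) * tdist m w' u)) ≤ K := fun w' => by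
    rw [hKdef]; exact torusSum_le d hm hgap w'
  have h₁ := letter_comp (tdist m)
    (fun x : TSite d (towerP L m (n + 1)) => blockCoord (L ^ (n + 1)) m (siteCast (towerP_eq_fineP_pow L m (n + 1)) x))
    (fun x : TSite d (towerP L m (n + 1)) => blockCoord (L ^ (n + 1)) m (siteCast (towerP_eq_fineP_pow L m (n + 1)) x))
    (id : TSite d m → TSite d m) GPcl Qcl (tdist_nonneg m) (fun u y w' => tdist_triangle hm u y w')
    (B₁ := BP) (B₂ := 1 * Real.exp (κ * 0)) (κ₁ := κ) (κ₂ := κ) (κ' := κ / 2) (S := K) hBP0 he0 hκh0 hκh hGp hQ hS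
  have h₂ := letter_comp (tdist m)
    (fun x : TSite d (towerP L m (n + 1)) => blockCoord (L ^ (n + 1)) m (siteCast (towerP_eq_fineP_pow L m (n + 1)) x))
    (id : TSite d m → TSite d m) (id : TSite d m → TSite d m) (Qcl ∘L GPcl) Ccl (tdist_nonneg m) (fun u y w' => tdist_triangle hm u y w')
    (B₁ := BP * (1 * Real.exp (κ * 0)) * K) (B₂ := BC) (κ₁ := κ / 2) (κ₂ := κ) (κ' := κ / 2) (S := K) hB1 hBC hκh0 le_rfl h₁ hCk hS
  have h₃ := letter_comp (tdist m)
    (fun x : TSite d (towerP L m (n + 1)) => blockCoord (L ^ (n + 1)) m (siteCast (towerP_eq_fineP_pow L m (n + 1)) x))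
    (id : TSite d m → TSite d m)
    (fun x : TSite d (towerP L m (n + 1)) => blockCoord (L ^ (n + 1)) m (siteCast (towerP_eq_fineP_pow L m (n + 1)) x))
    (Ccl ∘L (Qcl ∘L GPcl)) Qacl (tdist_nonneg m) (fun u y w' => tdist_triangle hm u y w')
    (B₁ := BP * (1 * Real.exp (κ * 0)) * K * BC * K) (B₂ := 1 * Real.exp (κ * 0)) (κ₁ := κ / 2) (κ₂ := κ) (κ' := κ / 2) (S := K)
    hB2 he0 hκh0 le_rfl h₂ hQa hS
  have h₄ := letter_comp (tdist m)
    (fun x : TSite d (towerP L m (n + 1)) => blockCoord (L ^ (n + 1)) m (siteCast (towerP_eq_fineP_pow L m (n + 1)) x))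
    (fun x : TSite d (towerP L m (n + 1)) => blockCoord (L ^ (n + 1)) m (siteCast (towerP_eq_fineP_pow L m (n + 1)) x))
    (fun x : TSite d (towerP L m (n + 1)) => blockCoord (L ^ (n + 1)) m (siteCast (towerP_eq_fineP_pow L m (n + 1)) x))
    (Qacl ∘L (Ccl ∘L (Qcl ∘L GPcl))) GPcl (tdist_nonneg m) (fun u y w' => tdist_triangle hm u y w')
    (B₁ := BP * (1 * Real.exp (κ * 0)) * K * BC * K * (1 * Real.exp (κ * 0)) * K) (B₂ := BP) (κ₁ := κ / 2) (κ₂ := κ) (κ' := κ / 2) (S := K)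
    hB3 hBP0 hκh0 le_rfl h₃ hGp hS
  -- (L)(R_k; B_R, κ∕2) as a CLM letter: `R_k g = g − G′_k(Q̃′_k†(c(Q̃′_k(G′_k g))))`, the identity letter for `g` plus the word `h₄`
  have hBRr0 : 0 ≤ BRr := by rw [hBRr]; exact add_nonneg zero_le_one (mul_nonneg (mul_nonneg hB3 hBP0) hK0)
  have hRL : ∀ (v : TSite d m) (g : SiteL2K ℂ d (towerP L m (n + 1)) c₀ W) (F : ℝ),
      (∀ x, blockCoord (L ^ (n + 1)) m (siteCast (towerP_eq_fineP_pow L m (n + 1)) x) ≠ v →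
        WL2.equiv ℂ (fun _ : TSite d (towerP L m (n + 1)) => c₀) W g x = 0) →
      (∀ x, ‖WL2.equiv ℂ (fun _ : TSite d (towerP L m (n + 1)) => c₀) W g x‖ ≤ F) →
      ∀ x, ‖WL2.equiv ℂ (fun _ : TSite d (towerP L m (n + 1)) => c₀) W (Rcl g) x‖ ≤
        BRr * Real.exp (-(κ / 2 * tdist m (blockCoord (L ^ (n + 1)) m (siteCast (towerP_eq_fineP_pow L m (n + 1)) x)) v)) * F := by
    intro v g F hgv hgF x
    have hF : 0 ≤ F := (norm_nonneg _).trans (hgF x)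
    have eR := RofUk_eq_formula L m n φ c₀ η U c₁ a' hRS hpos' g
    have e1 : Rcl g = g - (GPcl ∘L (Qacl ∘L (Ccl ∘L (Qcl ∘L GPcl)))) g := by
      rw [hRcl, LinearMap.coe_toContinuousLinearMap', eR]
      simp only [hGPcl, hQacl, hCcl, hQcl, hc, hQt, ContinuousLinearMap.comp_apply, LinearMap.coe_toContinuousLinearMap', LinearMap.comp_apply]
    have hid : ‖WL2.equiv ℂ (fun _ : TSite d (towerP L m (n + 1)) => c₀) W g x‖ ≤
        1 * Real.exp (-(κ / 2 * tdist m (blockCoord (L ^ (n + 1)) m (siteCast (towerP_eq_fineP_pow L m (n + 1)) x)) v)) * F := by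
      by_cases hx : blockCoord (L ^ (n + 1)) m (siteCast (towerP_eq_fineP_pow L m (n + 1)) x) = v
      · rw [hx, tdist_self, mul_zero, neg_zero, Real.exp_zero, one_mul, one_mul]; exact hgF x
      · rw [hgv x hx, norm_zero]; exact mul_nonneg (mul_nonneg zero_le_one (Real.exp_nonneg _)) hF
    have hword := h₄ v g F hgv hgF x
    rw [e1, WL2.equiv_sub, Pi.sub_apply]
    refine (norm_sub_le _ _).trans ((add_le_add hid hword).trans (le_of_eq ?_))
    rw [hBRr]; ring
  -- the fifth composition: outer `G′_k` at rate `κ`, inner `R_k` at `κ∕2`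
  have h₅ := letter_comp (tdist m)
    (fun x : TSite d (towerP L m (n + 1)) => blockCoord (L ^ (n + 1)) m (siteCast (towerP_eq_fineP_pow L m (n + 1)) x))
    (fun x : TSite d (towerP L m (n + 1)) => blockCoord (L ^ (n + 1)) m (siteCast (towerP_eq_fineP_pow L m (n + 1)) x))
    (fun x : TSite d (towerP L m (n + 1)) => blockCoord (L ^ (n + 1)) m (siteCast (towerP_eq_fineP_pow L m (n + 1)) x))
    Rcl GPcl (tdist_nonneg m) (fun u y w' => tdist_triangle hm u y w')
    (B₁ := BRr) (B₂ := BP) (κ₁ := κ / 2) (κ₂ := κ) (κ' := κ / 2) (S := K) hBRr0 hBP0 hκh0 le_rfl hRL hGp hS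
  have hE0 : 0 ≤ Real.exp (-(κ / 2 * tdist m (blockCoord (L ^ (n + 1)) m (siteCast (towerP_eq_fineP_pow L m (n + 1)) x)) v)) :=
    Real.exp_nonneg _
  refine ⟨?_, ?_, ?_⟩
  · -- `G′_k` alone, weakened to `κ∕2` and to `Bs`
    have h := hGp v w F hwv hwF x
    rw [hGPcl, LinearMap.coe_toContinuousLinearMap'] at h
    calc _ ≤ BP * Real.exp (-(κ * tdist m (blockCoord (L ^ (n + 1)) m (siteCast (towerP_eq_fineP_pow L m (n + 1)) x)) v)) * F := h
      _ ≤ BP * Real.exp (-(κ / 2 * tdist m (blockCoord (L ^ (n + 1)) m (siteCast (towerP_eq_fineP_pow L m (n + 1)) x)) v)) * F :=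
          mul_le_mul_of_nonneg_right (mul_le_mul_of_nonneg_left (exp_weaken' hκh (tdist_nonneg m _ _)) hBP0) hF0
      _ ≤ Bs * Real.exp (-(κ / 2 * tdist m (blockCoord (L ^ (n + 1)) m (siteCast (towerP_eq_fineP_pow L m (n + 1)) x)) v)) * F :=
          mul_le_mul_of_nonneg_right (mul_le_mul_of_nonneg_right (by rw [hBs]; exact (le_max_left _ _).trans (le_max_left _ _)) hE0) hF0
  · -- `R_k` alone
    have h := hRL v w F hwv hwF x
    rw [hRcl, LinearMap.coe_toContinuousLinearMap'] at h
    exact h.trans (mul_le_mul_of_nonneg_right (mul_le_mul_of_nonneg_right (by rw [hBs]; exact (le_max_right _ _).trans (le_max_left _ _)) hE0) hF0)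
  · -- `G′_k ∘ R_k`
    have h := h₅ v w F hwv hwF x
    rw [ContinuousLinearMap.comp_apply, hGPcl, LinearMap.coe_toContinuousLinearMap', hRcl, LinearMap.coe_toContinuousLinearMap'] at h
    exact h.trans (mul_le_mul_of_nonneg_right (mul_le_mul_of_nonneg_right (by rw [hBs]; exact le_max_right _ _) hE0) hF0)

end Literature.MathematicalPhysics.QuantumFieldTheory.Balaban1983to89.B9Eq325RofUkSupRowClosed

end
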